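import Summits.Ventures.QEC.Census.CertCoverBatch
import Summits.Ventures.QEC.Census.BB.A1s_n168_k6_48810f7d.CoreDefs
import HarnessLib

set_option Elab.async false
set_option maxRecDepth 200000

/-!
# `[[168,6,16]]` one-level cover certificate of `A1s_n168_k6_48810f7d` — LEVEL-1→0 coset problems 181…208 (deep problems [6] excluded: `ProbDeep*.lean`) as COMPACT data
(`ProbData`: U, f, σ, y₀, allow; qec-type-10 `CertCoverBatch.mkCoset` rebuilds each `CosetProb` in the kernel) + their verdict
`probsOK cov covR hx hx1 D1 lxd 14` (one `decide +kernel`; 28 problems, depths f=0:26 f=1:2 f=2:0 f=3:0, est. 107.0 s).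
qec-search-1 g5 (pattern of search-9 g5 `Probs*`); data from JSON `level10.problems` (sha256 30ee1c0603955da8…). Data + decided check; KERNEL.
-/

namespace Summit.Ventures.QEC.Census.A1s_n168_k6_48810f7d

open Matrix Summit.Ventures.QEC.Census Literature.InformationTheory.QuantumCodes

/-- Problems 181…208 (28): `⟨U, f, σ, y₀, allow⟩`. -/
def probs04a : List ProbData := [
    ⟨6051257140124115272705, 0, 21476958280, 1328314196493441434625, [0]⟩,
    ⟨6087426819758999224404, 0, 96771115552, 4869940435460395368528, [0]⟩,
    ⟨6087588799819922280704, 0, 21609072641, 1217486234765290897664, [0]⟩,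
    ⟨6096653701444876174400, 0, 21643162112, 1365063565054671127552, [0]⟩,
    ⟨6142770843104063849600, 0, 21542470656, 4796153459173073354752, [0]⟩,
    ⟨6198254700817682628608, 0, 1117105439744, 5017658573744263726431, []⟩,
    ⟨6198687050779955593217, 0, 1117102818376, 5903539075095202497604, []⟩,
    ⟨6217998425912825611600, 0, 85916134272, 6198106008783765504660, []⟩,
    ⟨6591252839980797001864, 0, 21562959424, 1203650613760038535296, [0]⟩,
    ⟨6789924044604388149250, 0, 21480128656, 1181744542222557118464, [0]⟩,
    ⟨8860201886057654386816, 0, 51560628992, 3542927836433399414784, [0]⟩,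
    ⟨8946671526668614500360, 1, 51606758720, 5386449339900523184256, [128, 134217728, 536870912]⟩,
    ⟨8952436169376012959744, 0, 51627730688, 3564833872786510315656, []⟩,
    ⟨10653141498639569397760, 0, 2354055223361, 9463326221936487309888, []⟩,
    ⟨10653573839805749471233, 0, 2354053650441, 9463182102350365008449, []⟩,
    ⟨10920778754252011014176, 0, 2147496771585, 18032232332432492, []⟩,
    ⟨10925373552630828180002, 0, 223410147345, 300047840277003838018, []⟩,
    ⟨11068335173797342085264, 0, 17448327360, 426610780012586, []⟩,
    ⟨11220242427116571869204, 0, 773161389216, 4611686029477366362, []⟩,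
    ⟨11234077344434334220340, 0, 773111055776, 10035028776101482875160, []⟩,
    ⟨13468575418996494434304, 0, 141769589248, 3728548145909890024408, []⟩,
    ⟨20074964241587600654984, 0, 335079019840, 18894079869324291899740, []⟩,
    ⟨20088632666794865759232, 0, 3040842359043, 20070113864852284379200, []⟩,
    ⟨20088812810779960030208, 1, 3040841048320, 20070366066431416610880, []⟩,
    ⟨20098069961806887002117, 0, 1391993028906, 20079623215534194046017, []⟩,
    ⟨20102627732070062883104, 0, 17595105600, 1208549971602176606212, []⟩,
    ⟨20228589061746265882688, 0, 292285846272, 1337393730419186794576, []⟩,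
    ⟨20256258896381924802560, 0, 292185178368, 18928088819475644284944, []⟩]

set_option maxHeartbeats 400000000 in
/-- Every problem of this chunk passes (`mkCoset` elimination + `cosetOKD` + fast `σ` + depth + `BU`-evenness + label checks). -/
theorem probs04a_ok : probsOK A1s_n168_k6_48810f7d.cov covR hx hx1 D1 lxd 14 probs04a = true := by
  decide +kernel

/-- Pointwise form. -/
theorem probs04a_all : ∀ x ∈ probs04a, probOK A1s_n168_k6_48810f7d.cov covR hx hx1 D1 lxd 14 x = true := by
  have h := probs04a_ok
  rwa [probsOK, List.all_eq_true] at h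

end Summit.Ventures.QEC.Census.A1s_n168_k6_48810f7d
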